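import Summits.CriticalPhenomena.PercolationContinuityZ3.Theorems.PercNearOneGluingNoHeavyQuantCritVolumeNoGoLemmas
import HarnessLib

/-!
# QUANT lane (p4 gen 18): NO-GO — the known critical-volume inequalities do not give pointwise `δ ≥ 2`

builds on p205010 (kernel theorem, internal audit signed; external expert review pending) — NOT used in this file (pure real
analysis).

Write `a_n = P_{p_c}(|C| ≥ n)`, `S_n = Σ_{k≤n} a_k = E_{p_c}[|C| ∧ n]` for bond percolation on `ℤ^d`.  The tree knows about the
sequence `(a_n)` alone: antitone, `a_1 = 1`, `a_n → 0` (p205010), `Σ a_n = ∞`, the Aizenman–Barsky/Newman generating-function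
bound `γΣ_s(1−γ)^s a_{s+1} ≥ c_M√γ` (tree `magnetization_criticalProb_ge_sqrt`; "δ ≥ 2" in the sense of HvdH 2017 Cor 4.5 / Grimmett
Prop (10.29)) and the Hutchcroft/Dewan–Muirhead product bound `a_nS_n ≥ c_P` (P4-MODULUS S87).  The POINTWISE bound `a_n ≥ c/√n` is
not in print for `d ≥ 3` (HvdH 2017 §4.3 p. 54).  **`critVolume_pointwise_noGo`**: for every `c_M ≤ 1/2`, `c_P ≤ 1`, `ε > 0` there is
a sequence with ALL these properties and `a_n < ε/√n` for some `n` — the plateau-then-drop witness of `…QuantCritVolumeNoGoLemmas`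
with `N = ⌈128/ε²⌉ + 5`, `N′ = ⌈16(N+1)/ε²⌉ + 1` (`ε ∧ 1` in place of `ε`).  So a pointwise proof of `δ ≥ 2` in `d ≥ 3` needs an
input that excludes volume plateaus at `p_c`; the three constraints pin exactly `a_n ≥ c/n` (S88).

HONEST: an elementary counterexample at the level of sequences (new as typed; a barrier statement, not a percolation theorem).

## References
* M. Heydenreich, R. van der Hofstad, *Progress in high-dimensional percolation and random graphs* (2017), §4.3, Cor. 4.5 [HeydenreichVanDerHofstad2017].
* G. Grimmett, *Percolation*, 2nd ed. (1999), Prop. (10.29) [GrimmettPercolation1999].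
-/

noncomputable section

namespace Summit.CriticalPhenomena.PercolationContinuityZ3.Theorems.CritVolumeNoGo

open Filter Topology Finset

/-! ### §5 The no-go theorem -/

/-- **NO-GO FOR POINTWISE `δ ≥ 2` FROM THE KNOWN CRITICAL-VOLUME INEQUALITIES.**  For every `c_M ≤ 1/2`, `c_P ≤ 1` and every
`ε > 0` there is a real sequence `a` which is antitone, has `a 1 = 1`, is positive, tends to `0`, is NOT summable, satisfies the
Aizenman–Barsky/Newman generating-function bound `c_M √γ ≤ γ Σ_s (1−γ)^s a_{s+1}` for all `γ ∈ (0,1)` and the product bound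
`c_P ≤ a_n · Σ_{k=1}^n a_k` for all `n ≥ 1` — and nevertheless `a_n < ε/√n` for some `n ≥ 1`.  Hence the pointwise mean-field
bound `P_{p_c}(|C| ≥ n) ≥ c/√n` is not a consequence of these properties of the critical volume tail. -/
theorem critVolume_pointwise_noGo {cM cP ε : ℝ} (hcM : cM ≤ 1 / 2) (hcP : cP ≤ 1) (hε : 0 < ε) :
    ∃ a : ℕ → ℝ, Antitone a ∧ a 1 = 1 ∧ (∀ n, 0 < a n) ∧ Tendsto a atTop (𝓝 0) ∧ ¬ Summable a ∧
      (∀ γ : ℝ, 0 < γ → γ < 1 → cM * Real.sqrt γ ≤ γ * ∑' s : ℕ, (1 - γ) ^ s * a (s + 1)) ∧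
      (∀ n : ℕ, 1 ≤ n → cP ≤ a n * ∑ k ∈ Icc 1 n, a k) ∧
      ∃ n : ℕ, 1 ≤ n ∧ a n < ε / Real.sqrt n := by
  -- wlog `ε ≤ 1`
  set ε₀ : ℝ := min ε 1 with hε₀
  have hε₀0 : 0 < ε₀ := lt_min hε one_pos
  have hε₀1 : ε₀ ≤ 1 := min_le_right _ _
  have hε₀ε : ε₀ ≤ ε := min_le_left _ _
  -- the parameters
  set N : ℕ := ⌈128 / ε₀ ^ 2⌉₊ + 5 with hN
  set N' : ℕ := ⌈16 * (N + 1) / ε₀ ^ 2⌉₊ + 1 with hN'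
  have hNr : 128 / ε₀ ^ 2 + 5 ≤ (N : ℝ) := by
    have := Nat.le_ceil (128 / ε₀ ^ 2); rw [hN]; push_cast; linarith
  have hN'r : 16 * ((N : ℝ) + 1) / ε₀ ^ 2 < (N' : ℝ) := by
    have := Nat.le_ceil (16 * ((N : ℝ) + 1) / ε₀ ^ 2); rw [hN']; push_cast; linarith
  have hN'r' : (N' : ℝ) ≤ 16 * ((N : ℝ) + 1) / ε₀ ^ 2 + 2 := by
    have := (Nat.ceil_lt_add_one (show (0 : ℝ) ≤ 16 * ((N : ℝ) + 1) / ε₀ ^ 2 by positivity)).le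
    rw [hN']; push_cast; linarith
  have hε2 : ε₀ ^ 2 ≤ 1 := by nlinarith
  have hε2pos : 0 < ε₀ ^ 2 := by positivity
  have h128 : (128 : ℝ) ≤ 128 / ε₀ ^ 2 := by rw [le_div_iff₀ hε2pos]; nlinarith
  have hN5 : (133 : ℝ) ≤ N := by linarith
  have hN2 : 2 ≤ N := by exact_mod_cast (show (2 : ℝ) ≤ N by linarith)
  -- `16(N+1) ≤ 16(N+1)/ε₀² < N'`
  have hNN'r : 16 * ((N : ℝ) + 1) < N' := by
    refine lt_of_le_of_lt ?_ hN'r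
    rw [le_div_iff₀ hε2pos]; nlinarith
  have hN'16 : 16 ≤ N' := by exact_mod_cast (show (16 : ℝ) ≤ N' by linarith)
  have hNN' : N ≤ N' := by exact_mod_cast (show (N : ℝ) ≤ N' by linarith)
  -- `4N' + 2 ≤ N²`: from `N ≥ 128/ε₀² + 5` and `N' ≤ 16(N+1)/ε₀² + 2`
  have hsq : 4 * N' + 2 ≤ N ^ 2 := by
    have hN0 : (0 : ℝ) ≤ N := by positivity
    have h1 : (N : ℝ) * (128 / ε₀ ^ 2) + 5 * N ≤ (N : ℝ) ^ 2 := by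
      have := mul_le_mul_of_nonneg_left hNr hN0
      nlinarith
    have h2 : (4 : ℝ) * N' + 2 ≤ 4 * (16 * ((N : ℝ) + 1) / ε₀ ^ 2) + 10 := by linarith
    have h3 : 4 * (16 * ((N : ℝ) + 1) / ε₀ ^ 2) ≤ (N : ℝ) * (128 / ε₀ ^ 2) := by
      rw [show 4 * (16 * ((N : ℝ) + 1) / ε₀ ^ 2) = (64 * ((N : ℝ) + 1)) / ε₀ ^ 2 by ring,
        show (N : ℝ) * (128 / ε₀ ^ 2) = (128 * (N : ℝ)) / ε₀ ^ 2 by ring]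
      exact div_le_div_of_nonneg_right (by linarith) hε2pos.le
    have : (4 : ℝ) * N' + 2 ≤ (N : ℝ) ^ 2 := by linarith
    exact_mod_cast this
  have hN'le : N' ≤ 16 * N ^ 2 :=
    calc N' ≤ 4 * N' + 2 := by omega
      _ ≤ N ^ 2 := hsq
      _ ≤ 16 * N ^ 2 := Nat.le_mul_of_pos_left _ (by norm_num)
  -- the witness
  set a : ℕ → ℝ := fun k => if k ≤ N then 1 else if k ≤ N' then 4 / Real.sqrt N' else 4 / Real.sqrt k with hadef
  have ha : ∀ k, a k = if k ≤ N then 1 else if k ≤ N' then 4 / Real.sqrt N' else 4 / Real.sqrt k := fun k => rfl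
  refine ⟨a, seqA_antitone ha hN'16 hNN', seqA_of_le_N ha (by omega), seqA_pos ha hN'16, seqA_tendsto_zero ha hNN',
    seqA_not_summable ha hNN', fun γ h0 h1 => gf_bound ha hN'16 hNN' hN2 hsq hcM h0 h1,
    fun n hn => product_bound ha hN'16 hNN' hN'le hcP hn, N + 1, by omega, ?_⟩
  -- the drop: `a_{N+1} = 4/√N' < ε₀/√(N+1) ≤ ε/√(N+1)`
  rw [seqA_of_mid ha (Nat.lt_succ_self N) (by exact_mod_cast (show (N : ℝ) + 1 ≤ N' by linarith))]
  have hN10 : (0 : ℝ) < (N + 1 : ℕ) := by positivity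
  have hsN1 : 0 < Real.sqrt ((N + 1 : ℕ) : ℝ) := Real.sqrt_pos.2 hN10
  have hsN' : 0 < Real.sqrt N' := Real.sqrt_pos.2 (by exact_mod_cast (show 0 < N' by omega))
  calc 4 / Real.sqrt N' < ε₀ / Real.sqrt ((N + 1 : ℕ) : ℝ) := by
        rw [div_lt_div_iff₀ hsN' hsN1]
        -- `4√(N+1) < ε₀ √N'` from `16(N+1) < ε₀² N'`
        have hlt : Real.sqrt (16 * ((N + 1 : ℕ) : ℝ)) < Real.sqrt (ε₀ ^ 2 * N') := by
          apply Real.sqrt_lt_sqrt (by positivity)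
          push_cast
          have h' := (div_lt_iff₀ hε2pos).1 hN'r
          have hc : (N' : ℝ) * ε₀ ^ 2 = ε₀ ^ 2 * N' := mul_comm _ _
          linarith
        rw [Real.sqrt_mul (by norm_num), Real.sqrt_mul (by positivity), Real.sqrt_sq hε₀0.le,
          show Real.sqrt 16 = 4 by rw [show (16 : ℝ) = 4 ^ 2 by norm_num, Real.sqrt_sq (by norm_num)]] at hlt
        linarith
    _ ≤ ε / Real.sqrt ((N + 1 : ℕ) : ℝ) := div_le_div_of_nonneg_right hε₀ε hsN1.le

end Summit.CriticalPhenomena.PercolationContinuityZ3.Theorems.CritVolumeNoGo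

end
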